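import Mathlib
import Summits.Ventures.PercRepro2.TB14Fold

/-!
# The covariance form of typed BHK 1.4 (single-vertex, row 2′TB)
(blind cell PercRepro2, p5 g3, 2026-08-25; P5-TB14.md §11.1)

Two-copy vocabulary of `A3InactiveTyped` / `TB14Fold`: first copy `y`, second copy
`w = flipOn F y`; `pairCount F z Φ = Σ_y Φ y w` over the admissible `y`. With
`F(y,w) = 1_{b∈C₁}(y) − 1_{b∈C₁}(w)` and `G(y,w) = 1_{o∈C₂}(w) − 1_{o∈C₂}(y)` (both antisymmetric
under the exchange of the copies), the (TB14) slack `N(QAB, Q) − N(QB, QA)` satisfies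

  `2 · (N(QAB, Q) − N(QB, QA)) = − Σ_{y : Q(y) Q(w)} F(y,w) · G(y,w)`,

so **(TB14) at a profile ⟺ the «covariance count» `pairCount F z covBO` is nonnegative** — under the
uniform law on the configurations in which `a₁ ↮ a₂` in both copies, the random variables
`[b ∈ C₁] − [b ∈ C₁']` and `[o ∈ C₂'] − [o ∈ C₂]` are positively correlated (both have mean 0 by the
exchange of the copies). Proof: expand, and use that the folded summand of `TB14Fold` with the copies
exchanged has the same `pairCount` (`pairCount_swap`).
Nothing here proves (TB14); it is the statement of record in covariance form. Axioms: standard.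
-/

namespace Summit.Ventures.PercRepro2

namespace TB14Cov

open CovForm A3InactiveTyped TB14Fold

variable {V : Type} {E : Type} [Fintype E] [DecidableEq E] {R : Type*} [Field R]

/-- The covariance summand
`1_Q(y)·1_Q(w)·(1_{b∈C₁}(y) − 1_{b∈C₁}(w))·(1_{o∈C₂}(w) − 1_{o∈C₂}(y))`. -/
noncomputable def covBO (ends : E → Sym2 V) (a₁ a₂ b o : V) : Config E → Config E → R :=
  fun y w => iQ ends a₁ a₂ y * iQ ends a₁ a₂ w * (iL ends a₁ b y - iL ends a₁ b w) *
    (iH ends a₂ o w - iH ends a₂ o y)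

omit [Fintype E] [DecidableEq E] in
/-- Pointwise: the covariance summand is minus the folded summand minus the folded summand with the
copies exchanged. -/
lemma covBO_eq_fold (ends : E → Sym2 V) (a₁ a₂ b o : V) :
    (covBO ends a₁ a₂ b o : Config E → Config E → R) =
      fun y w => -(foldBO ends a₁ a₂ b o y w) - foldBO ends a₁ a₂ b o w y := by
  funext y w
  simp only [covBO, foldBO]
  ring

/-- The count of a negated summand. -/
lemma pairCount_neg (F : Finset E) (z : Config E) (Φ : Config E → Config E → R) :
    pairCount F z (fun y w => -(Φ y w)) = -pairCount F z Φ := by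
  have h := pairCount_const_mul F z (-1 : R) Φ
  simp only [neg_mul, one_mul] at h
  exact h

/-- **The covariance count is minus twice the folded count.** -/
theorem pairCount_cov (ends : E → Sym2 V) (a₁ a₂ b o : V) (F : Finset E) (z : Config E) :
    pairCount F z (covBO ends a₁ a₂ b o : Config E → Config E → R) =
      -(2 * pairCount F z (foldBO ends a₁ a₂ b o)) := by
  rw [covBO_eq_fold, pairCount_sub, pairCount_neg,
    ← pairCount_swap F z (foldBO ends a₁ a₂ b o)]
  ring

/-- **The (TB14) slack in covariance form**:
`2·(N(QAB, Q) − N(QB, QA)) = − pairCount F z covBO`. -/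
theorem tb14_slack_eq_cov (ends : E → Sym2 V) (a₁ a₂ b o : V) (F : Finset E) (z : Config E) :
    2 * (pairCount F z (sameBO ends a₁ a₂ b o : Config E → Config E → R) -
        pairCount F z (crossBO ends a₁ a₂ b o)) =
      -pairCount F z (covBO ends a₁ a₂ b o) := by
  rw [pairCount_fold, pairCount_cov]
  ring

/-- **(TB14) at a profile ⟺ the covariance count is nonnegative.** -/
theorem tb14_iff_cov [LinearOrder R] [IsStrictOrderedRing R] (ends : E → Sym2 V) (a₁ a₂ b o : V)
    (F : Finset E) (z : Config E) :
    pairCount F z (sameBO ends a₁ a₂ b o : Config E → Config E → R) ≤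
        pairCount F z (crossBO ends a₁ a₂ b o) ↔
      0 ≤ pairCount F z (covBO ends a₁ a₂ b o : Config E → Config E → R) := by
  have h : 2 * (pairCount F z (sameBO ends a₁ a₂ b o : Config E → Config E → R) -
      pairCount F z (crossBO ends a₁ a₂ b o)) =
      -pairCount F z (covBO ends a₁ a₂ b o : Config E → Config E → R) :=
    tb14_slack_eq_cov ends a₁ a₂ b o F z
  constructor
  · intro hle
    linarith
  · intro hc
    linarith

end TB14Cov

end Summit.Ventures.PercRepro2
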